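import Summits.Langlands.Langlands.Theorems.ExteriorSquareAscentSelfTwistedIrreducibleDefs
import Summits.Langlands.Langlands.Theorems.ExteriorSquareAscentSelfTwistedIrreducibleStubNoFourCharactersAux
import Literature.NumberTheory.Automorphic.BockleHuiIrreducibleGL3AnalyticProofs
import Literature.NumberTheory.Automorphic.GLnAdelicStructureProofs
import Literature.NumberTheory.Automorphic.IdeleNormDetGL
import Literature.NumberTheory.Automorphic.CuspidalDescentDetCubicRepData
import Literature.NumberTheory.GaloisRepresentations.PowLocallyAlgebraicProofs
import Literature.NumberTheory.GaloisRepresentations.ModNCyclotomicCharacter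
import Literature.NumberTheory.GaloisRepresentations.SatakeFamilyOfFramedGaloisRep
import HarnessLib

/-!
# Crux `SelfTwistedIrreducible` (stmt-Langlands-18055), line `Sketch`: stub `stub_noFourCharacters`
# (shape (A) — a sum of four characters — is impossible)

Setting: `L/K` quadratic with `τ ∈ Aut(L/K)`, `f` a cuspidal Borel–Jacquet datum on `GL₂(𝔸_L)`,
`ρ' : Γ_L → GL₄(ℚ̄_ℓ)` semisimple, `E`-rational almost everywhere (`IsRationalAE`) and compatible with
`f ⊞ f^τ` (`IsCompatibleAlong τ f ι ρ'`: at a.e. `w`, `charpoly ρ'(Frob_w) = arithFrobPolyOfSatake ι q_w 4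
(t_{f,w} ⊔ t_{f,τw})`, C-normalisation).  **Claim** (`stub_noFourCharacters`, registered stub of the
checked skeleton, fed with the Jacquet–Shalika named facts (2.2)/(2.3) for Borel–Jacquet data as
hypotheses): `ρ'` is not of shape (A), `charpoly ρ'(σ) = ∏_{i<4} (X - χ_i(σ))` for continuous
characters `χ_i` (`IsSumOfFourCharacters`).

**Proof.**
1. *Galois → Hecke* (`weaklyDivides_ofCharacter_of_charpoly_eq_prod`,
   `exists_heckeCharacter_satake_add_smul`).  Each `χ_i`, as a rank-one representation
   (`FramedRep.ofCharacter`), weakly divides `ρ'` (`X - χ_i(σ)` divides the product; where `ρ'(σ) = 1`,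
   `∏ (X - χ_i σ) = (X - 1)⁴` forces `χ_i(σ) = 1`), so Böckle–Hui's Theorem 1.1 — PROVED on the tree,
   `exists_heckeCharacter_of_weaklyDivides_holds` — gives algebraic Hecke characters `η_i` of `L` with
   `χ_i(Frob_w) = ι⁻¹(η_i(ϖ_w))⁻¹` a.e.  At a.e. `w`, with a Frobenius `Φ`
   (`exists_isArithFrobAt_of_mem_primesAbove_holds`), `charpoly ρ'(Φ)` is both
   `arithFrobPolyOfSatake ι q_w 4 (β ⊔ β')` and `∏_i (X - ι⁻¹(η_i(ϖ_w))⁻¹)`; inverting the dictionary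
   (`map_satakeParamOfFrobEigenvalue_roots_arithFrobPolyOfSatake`) yields
   `β ⊔ β' = {η_i(ϖ_w) · q_w^{-3/2}}_i` (`(√q)³ = q^{3/2}`, `sqrt_pow_three_eq_cpow`).
2. *Kill.*  `η_i · ‖·‖^{3/2}` (`exists_heckeCharacter_ideleNorm_cpow`, value `q_w^{-3/2}` at `ϖ_w`) is the
   Satake parameter of a cuspidal `GL₁` datum `σ_i`
   (`exists_cuspidal_glOne_hasSatakeParamAt_valueAtUniformizer`), so a.e.
   `t_{f,w} ⊔ t_{f,τw} = ⨆_i t_{σ_i,w}` with `rank σ_i = 1 ≠ 2`, contradicting isobaric rigidity for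
   `f ⊞ f^τ` (`not_eventually_satake_add_smul_eq_sum_of_JS`, the auxiliary file, from (2.2)/(2.3)).

References: Böckle–Hui, Math. Ann. 393 (2025), Thm. 1.1, §3.2.1 [BockleHui2025]; Jacquet–Shalika,
Amer. J. Math. 103 (1981), Thm. 4.4 [JacquetShalikaAJM1981II]; Arthur–Clozel, Ann. of Math. Stud. 120,
Ch. 3 §2, Thm. 4.2 (d) [ArthurClozelAMS120].
-/

set_option linter.dupNamespace false -- `Summit.Langlands.Langlands` is the mandated namespace

noncomputable section

namespace Summit.Langlands.Langlands.Cruxes.SelfTwistedIrreducible.DetPinning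

open scoped NumberField Polynomial Classical
open Filter Polynomial NumberField IsDedekindDomain Field
open Literature.NumberTheory.GaloisRepresentations Literature.NumberTheory.Automorphic

/-! ### The Galois side: Böckle–Hui and the Satake identity -/

section Galois

variable {L : Type} [Field L] [NumberField L] {ℓ : ℕ} [Fact ℓ.Prime]

/-- **Each of the four characters weakly divides `ρ'`.**  If `charpoly ρ'(σ) = ∏_i (X - χ_i(σ))` for
every `σ` and `ρ'` is unramified almost everywhere, then the rank-one representation `χ_i`
(`FramedRep.ofCharacter`) weakly divides `ρ'` (`WeaklyDivides.of_eventually`): `X - χ_i(σ)` divides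
the product, and where `ρ'(σ) = 1` the identity `∏_i (X - χ_i σ) = (X - 1)^4` forces `χ_i σ = 1`.
[cite: BockleHui2025, §1.1] -/
theorem weaklyDivides_ofCharacter_of_charpoly_eq_prod {ρ' : FramedGaloisRep L (PadicAlgCl ℓ) 4}
    {χ : Fin 4 → (absoluteGaloisGroup L →ₜ* (PadicAlgCl ℓ)ˣ)}
    (hχ : ∀ σ : absoluteGaloisGroup L,
      (ρ' σ).val.charpoly = ∏ i, (X - C ((χ i σ : (PadicAlgCl ℓ)ˣ) : PadicAlgCl ℓ)))
    (hunr : ∀ᶠ w : HeightOneSpectrum (𝓞 L) in cofinite, ρ'.IsUnramifiedAt w) (i : Fin 4) :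
    FramedGaloisRep.WeaklyDivides (FramedRep.ofCharacter (χ i) : FramedGaloisRep L (PadicAlgCl ℓ) 1)
      ρ' := by
  refine FramedGaloisRep.WeaklyDivides.of_eventually (hunr.mono fun w hw => ⟨hw, ?_, ?_⟩)
  · intro 𝔓 h𝔓 σ hσ
    have h1 : ρ' σ = 1 := hw 𝔓 h𝔓 σ hσ
    have h2 := hχ σ
    rw [h1, Units.val_one, Matrix.charpoly_one, Fintype.card_fin] at h2
    have hdvd :
        X - C ((χ i σ : (PadicAlgCl ℓ)ˣ) : PadicAlgCl ℓ) ∣ ((X : (PadicAlgCl ℓ)[X]) - 1) ^ 4 := by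
      rw [h2]
      exact Finset.dvd_prod_of_mem _ (Finset.mem_univ i)
    have hroot : ((χ i σ : (PadicAlgCl ℓ)ˣ) : PadicAlgCl ℓ) = 1 := by
      rw [Polynomial.dvd_iff_isRoot, Polynomial.IsRoot.def, Polynomial.eval_pow, eval_sub, eval_X,
        eval_one] at hdvd
      exact sub_eq_zero.mp ((pow_eq_zero_iff (by norm_num)).mp hdvd)
    refine Units.ext (Matrix.ext fun a b => ?_)
    rw [FramedRep.ofCharacter_apply_coe, hroot, Units.val_one, Subsingleton.elim a b,
      Matrix.one_apply_eq]
  · intro 𝔓 _ σ _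
    rw [FramedRep.charpoly_ofCharacter]
    change _ ∣ (ρ' σ).val.charpoly
    rw [hχ σ]
    exact Finset.dvd_prod_of_mem _ (Finset.mem_univ i)

/-- `∑_{i} {x_i} = {x_i}_i` as multisets. [folklore] -/
theorem sum_singleton_eq_map {ι : Type*} (s : Finset ι) (x : ι → ℂ) :
    ∑ i ∈ s, ({x i} : Multiset ℂ) = s.val.map x := by
  rw [Finset.sum_eq_multiset_sum, ← Multiset.sum_map_singleton (s.val.map x), Multiset.map_map]
  rfl

variable {K : Type} [Field K] [Algebra K L]

/-- **Böckle–Hui + the Satake identity.**  For `ρ' : Γ_L → GL₄(ℚ̄_ℓ)` semisimple, `E`-rational a.e.,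
compatible with `f ⊞ f^τ` (C-normalisation `m = 4`) and of shape (A) (charpoly `∏_i (X - χ_i)`),
there are Hecke characters `η_i` of `L` (algebraic, from Böckle–Hui Thm. 1.1 applied to each `χ_i`,
`exists_heckeCharacter_of_weaklyDivides_holds`: `χ_i(Frob_w) = ι⁻¹(η_i(ϖ_w))⁻¹` a.e.) with, at almost
every `w`, `t_{f,w} ⊔ t_{f,τw} = {η_i(ϖ_w) q_w^{-3/2}}_i`: both sides have the same image
`charpoly ρ'(Frob_w)` under the injective dictionary `arithFrobPolyOfSatake ι q_w 4`
(`map_satakeParamOfFrobEigenvalue_roots_arithFrobPolyOfSatake`).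
[cite: BockleHui2025, Theorem 1.1 and §3.2.1] -/
theorem exists_heckeCharacter_satake_add_smul (τ : L ≃ₐ[K] L)
    {hL2 : isCompact_glFiniteIntegralLevel 2 L} (f : CuspidalAutomorphicRepData 2 L hL2)
    (ι : PadicAlgCl ℓ ≃+* ℂ)
    {ρ' : FramedGaloisRep L (PadicAlgCl ℓ) 4} (hss : ρ'.toGaloisRep.IsSemisimple)
    (hrat : IsRationalAE ρ') (hcomp : IsCompatibleAlong τ f ι ρ') (h4 : IsSumOfFourCharacters ρ') :
    ∃ η : Fin 4 → HeckeCharacter L, ∀ᶠ w : HeightOneSpectrum (𝓞 L) in cofinite,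
      ∀ β β' : Multiset ℂ, f.1.HasSatakeParamAt w β → f.1.HasSatakeParamAt (τ • w) β' →
        β + β' = ∑ i, {HeckeCharacter.valueAtUniformizer (η i) w *
          (((Real.sqrt (w.residueCard : ℝ) : ℝ) : ℂ) ^ (4 - 1))⁻¹} := by
  obtain ⟨χ, hχ⟩ := h4
  obtain ⟨E, _, _, e, he⟩ := hrat
  have hrat' : ρ'.IsRationalOver e := he
  have hunr : ∀ᶠ w : HeightOneSpectrum (𝓞 L) in cofinite, ρ'.IsUnramifiedAt w :=
    hrat'.eventually_isUnramifiedAt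
  have hBH := fun i : Fin 4 =>
    exists_heckeCharacter_of_weaklyDivides_holds L ℓ 4 E e ρ' hss hrat' _
      (weaklyDivides_ofCharacter_of_charpoly_eq_prod hχ hunr i) ι
  choose η _halg hη using hBH
  refine ⟨η, ?_⟩
  have hη' : ∀ᶠ w : HeightOneSpectrum (𝓞 L) in cofinite, ∀ i,
      FramedGaloisRep.HasFrobCharpolyAt w (X - C (ι.symm ((η i).valueAtUniformizer w)⁻¹))
        (FramedRep.ofCharacter (χ i) : FramedGaloisRep L (PadicAlgCl ℓ) 1) :=
    eventually_all.2 fun i => (hη i).mono fun w hw => hw.2.2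
  filter_upwards [hcomp, hη'] with w hw hηw β β' hβ hβ'
  obtain ⟨-, hP⟩ := hw β β' hβ hβ'
  obtain ⟨𝔓, h𝔓⟩ := HeightOneSpectrum.primesAbove_nonempty w
  obtain ⟨Φ, hΦ⟩ := HeightOneSpectrum.exists_isArithFrobAt_of_mem_primesAbove_holds h𝔓
  have h1 : FramedRep.charpoly ρ' Φ = arithFrobPolyOfSatake ι w.residueCard 4 (β + β') :=
    hP 𝔓 h𝔓 Φ hΦ
  have h2 : FramedRep.charpoly ρ' Φ = ∏ i, (X - C ((χ i Φ : (PadicAlgCl ℓ)ˣ) : PadicAlgCl ℓ)) :=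
    hχ Φ
  have h3 : ∀ i, ((χ i Φ : (PadicAlgCl ℓ)ˣ) : PadicAlgCl ℓ) =
      ι.symm ((η i).valueAtUniformizer w)⁻¹ := by
    intro i
    have h := hηw i 𝔓 h𝔓 Φ hΦ
    rwa [FramedRep.charpoly_ofCharacter, sub_right_inj, C_inj] at h
  have hq : 0 < w.residueCard := zero_lt_one.trans w.one_lt_residueCard
  have key := map_satakeParamOfFrobEigenvalue_roots_arithFrobPolyOfSatake ι hq 4 (β + β')
  have hmm : (Finset.univ.val.map fun i => X - C ((χ i Φ : (PadicAlgCl ℓ)ˣ) : PadicAlgCl ℓ)) =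
      ((Finset.univ.val.map fun i => ((χ i Φ : (PadicAlgCl ℓ)ˣ) : PadicAlgCl ℓ)).map
        fun r => X - C r) := by
    rw [Multiset.map_map]
    rfl
  rw [← h1, h2, Finset.prod_eq_multiset_prod, hmm, Polynomial.roots_multiset_prod_X_sub_C,
    Multiset.map_map] at key
  rw [← key, sum_singleton_eq_map]
  refine Multiset.map_congr rfl fun i _ => ?_
  simp only [Function.comp_apply, satakeParamOfFrobEigenvalue, h3 i, RingEquiv.apply_symm_apply,
    inv_inv]
  exact mul_comm _ _

end Galois

/-! ### The stub -/

section Stub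

/-- `(√q)^{4-1} = q^{3/2}` as complex numbers. [folklore] -/
theorem sqrt_pow_three_eq_cpow (q : ℕ) :
    (((Real.sqrt (q : ℝ) : ℝ) : ℂ) ^ (4 - 1)) = (q : ℂ) ^ ((3 / 2 : ℂ)) := by
  have hq : (0 : ℝ) ≤ q := Nat.cast_nonneg q
  have h1 : ((Real.sqrt (q : ℝ)) : ℝ) ^ (3 : ℕ) = (q : ℝ) ^ ((3 / 2 : ℝ)) := by
    rw [Real.sqrt_eq_rpow, ← Real.rpow_natCast, ← Real.rpow_mul hq]
    norm_num
  rw [show (4 - 1 : ℕ) = 3 from rfl, ← Complex.ofReal_pow, h1, Complex.ofReal_cpow hq]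
  push_cast
  rfl

/-- **Stub 4 (no four characters).**  Over the quadratic `L/K` with `τ ≠ 1`, for `f` cuspidal on
`GL₂/L` and a semisimple `ρ' : Γ_L → GL₄(ℚ̄_ℓ)` which is `E`-rational a.e. and compatible with
`f ⊞ f^τ`, shape (A) (`charpoly ρ'(σ) = ∏` of four continuous characters) is impossible, granted
Jacquet–Shalika (2.2)/(2.3) for Borel–Jacquet data: Böckle–Hui makes the characters algebraic Hecke
characters `η_i` with `t_{f,w} ⊔ t_{f,τw} = {q_w^{-3/2} η_i(ϖ_w)}_i` a.e.
(`exists_heckeCharacter_satake_add_smul`), the `q_w^{-3/2} η_i` are the Satake parameters of cuspidal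
`GL₁` data (`exists_cuspidal_glOne_hasSatakeParamAt_valueAtUniformizer`, norm twist
`exists_heckeCharacter_ideleNorm_cpow`), and isobaric rigidity for `f ⊞ f^τ`
(`not_eventually_satake_add_smul_eq_sum_of_JS`) kills that. -/
theorem stub_noFourCharacters :
    JacquetShalika1981_partialPairL_boundary_repData → JacquetShalika1981_partialPairL_pole_repData →
    ∀ (K : Type) [Field K] [NumberField K] (L : Type) [Field L] [NumberField L] [Algebra K L]
      (τ : L ≃ₐ[K] L), τ ≠ 1 → Module.finrank K L = 2 →
      ∀ (hL2 : isCompact_glFiniteIntegralLevel 2 L) (f : CuspidalAutomorphicRepData 2 L hL2)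
        (ℓ : ℕ) [Fact ℓ.Prime] (ι : PadicAlgCl ℓ ≃+* ℂ) (ρ' : FramedGaloisRep L (PadicAlgCl ℓ) 4),
        ρ'.toGaloisRep.IsSemisimple → IsRationalAE ρ' → IsCompatibleAlong τ f ι ρ' →
          ¬ IsSumOfFourCharacters ρ' := by
  intro hJSb hJSp K _ _ L _ _ _ τ _ _ hL2 f ℓ _ ι ρ' hss hrat hcomp h4
  obtain ⟨η, hη⟩ := exists_heckeCharacter_satake_add_smul τ f ι hss hrat hcomp h4
  obtain ⟨N, hN⟩ := exists_heckeCharacter_ideleNorm_cpow L (3 / 2 : ℂ)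
  have hL1 : isCompact_glFiniteIntegralLevel 1 L := isCompact_glFiniteIntegralLevel_holds 1 L
  have hσ : ∀ i : Fin 4, ∃ σ₁ : CuspidalAutomorphicRepData 1 L hL1,
      ∀ᶠ w : HeightOneSpectrum (𝓞 L) in cofinite,
        σ₁.1.HasSatakeParamAt w {(η i * N).valueAtUniformizer w} := fun i =>
    exists_cuspidal_glOne_hasSatakeParamAt_valueAtUniformizer hL1 (η i * N)
  choose σ₁ hσ₁ using hσ
  refine not_eventually_satake_add_smul_eq_sum_of_JS hJSb hJSp K L τ 2 hL2 f 4 (fun _ => 1)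
    (fun _ => hL1) σ₁ two_pos (fun _ => one_pos) (fun _ => by decide) ?_
  filter_upwards [hη, eventually_all.2 hσ₁] with w hw hσw a a' ha ha'
  refine ⟨fun i => {(η i * N).valueAtUniformizer w}, hσw, ?_⟩
  rw [hw a a' ha ha']
  refine Finset.sum_congr rfl fun i _ => ?_
  dsimp only
  rw [HeckeCharacter.valueAtUniformizer_mul, HeckeCharacter.valueAtUniformizer_of_cpow hN w,
    sqrt_pow_three_eq_cpow]

end Stub

end Summit.Langlands.Langlands.Cruxes.SelfTwistedIrreducible.DetPinning

end
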